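/-
Copyright: general combinatorics (lit-balaban cell, Phase-2 proof seat p13, gen 13). No claims beyond what the kernel
checks below.
-/
import Literature.Probability.LatticeModels.UrsellInversion
import Mathlib.Data.Fintype.Pi

/-!
# Ursell functions are multilinear in the clusters: sums over independent colourings

statement-level skeleton of published theorems with citation tags; proofs where landed; nothing here is a claim
about the Yang–Mills mass gap

A companion of `UrsellInversion.lean` / `UrsellMultilinear.lean` (linearity in ONE argument,
`ursellOf_eq_sum_mul_of_linear`).  Here: SIMULTANEOUS multilinearity in all the clusters of a vertex family
`V : Finset (Option J)` (clusters `some j`, one distinguished vertex `none` — the convention of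
`UrsellConnectedDiagrams.LegDiagram`), in the form produced by expanding each cluster's random variable as a finite sum
over "colours" (`X_j = Σ_{c ∈ K j} X_{j,c}`, e.g. the block vertices `ΦᵀM_BΦ = Σ_x Φ(e_x)Φ(M_Bᵀe_x)` of
Bałaban–Imbrie–Jaffe 1988 §5.13): if the moments are sums over independent colourings `z : J → S` of the clusters
present, `m(P) = Σ_{z ∈ piFinset (colours K z₀ P)} m_z(P)` with `m_z(P)` depending only on the colours of the clusters of
`P` (`colours K z₀ P j = K j` if `some j ∈ P`, else the frozen base colour `{z₀ j}`), then

  `mᵀ(V) = Σ_{z ∈ piFinset (colours K z₀ V)} m_zᵀ(V)`        (`ursellOf_piFinset`, `V` nonempty)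

(V. Mastropietro, *Non-Perturbative Renormalization* (2008) §2.3 (2.32)–(2.36): `𝓔ᵀ(X₁,…,X_p)` is the mixed
`λ`-derivative of `log 𝓔(e^{Σλ_iX_i})`, hence multilinear; D. Ruelle 1969 §4.4.2).  The combinatorial engine is the
exchange of a product of colour sums over the blocks of a set partition with one colour sum over the whole family,
`prod_sum_piFinset_of_isSetPartition` (two disjoint families: `sum_piFinset_mul_sum_piFinset`), and uniqueness of the
Möbius inversion (`eq_ursellOf_of_forall`).

HONEST SCOPE: pure finite combinatorics over a commutative ring; no measure.  Locality of `ursellOf`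
(`QuantumLattice.UrsellMomentDerivative.ursellOf_congr_of_subset`) is used through a private copy to keep the imports
basic.
-/

open Finset

namespace Literature.Probability.LatticeModels

variable {α : Type*} [DecidableEq α] {C : Type*} [CommRing C]

/-! ## §1  Locality (private copy) -/

/-- Locality: the Ursell function at `V` depends only on the moments of the subsets of `V` (a private copy of
`QuantumLattice.UrsellMomentDerivative.ursellOf_congr_of_subset`, not imported to keep this file basic). [folklore] -/
private theorem ursellOf_congr {m m' : Finset α → C} {V : Finset α} (h : ∀ P ⊆ V, m P = m' P) :
    ursellOf m V = ursellOf m' V := by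
  induction V using Finset.strongInduction with
  | H V ih =>
    rw [ursellOf_eq, ursellOf_eq, h V Subset.rfl]
    congr 1
    refine sum_congr rfl fun π hπ => prod_congr rfl fun P hP => ?_
    obtain ⟨hne, hπ'⟩ := mem_erase.1 hπ
    have hsp := mem_setPartitions.1 hπ'
    have hPV : P ⊂ V := hsp.ssubset_of_ne_singleton hne hP
    exact ih P hPV fun Q hQ => h Q (hQ.trans hPV.subset)


/-! ## §2  Multilinearity in the clusters (colourings of the vertices `some j`) -/

section PiFinset

variable {J : Type*} [DecidableEq J] [Fintype J] {S : Type*} (K : J → Finset S) (z₀ : J → S)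

/-- The colour ranges of a vertex family: a cluster `j` present in `P` ranges over `K j`, an absent one is frozen at
the base colour `z₀ j`. [cite: Mastropietro2008, §2.3 (2.32)-(2.36)] -/
def colours (P : Finset (Option J)) (j : J) : Finset S := if some j ∈ P then K j else {z₀ j}

/-- Membership in the colourings of a family: free on the clusters present, frozen elsewhere.
[cite: Mastropietro2008, §2.3 (2.32)-(2.36)] -/
theorem mem_piFinset_colours {P : Finset (Option J)} {z : J → S} :
    z ∈ Fintype.piFinset (colours K z₀ P) ↔
      (∀ j, some j ∈ P → z j ∈ K j) ∧ ∀ j, some j ∉ P → z j = z₀ j := by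
  rw [Fintype.mem_piFinset]
  constructor
  · intro h
    refine ⟨fun j hj => ?_, fun j hj => ?_⟩
    · have := h j
      rwa [colours, if_pos hj] at this
    · have := h j
      rwa [colours, if_neg hj, mem_singleton] at this
  · rintro ⟨h1, h2⟩ j
    by_cases hj : some j ∈ P
    · rw [colours, if_pos hj]
      exact h1 j hj
    · rw [colours, if_neg hj, mem_singleton]
      exact h2 j hj

/-- **Exchange of a product of two colour sums over disjoint vertex families**: for `f` depending only on the colours
of the clusters of `A`, `g` only on those of `B`, `A ∩ B = ∅`,
`(Σ_{z ∈ Π t_A} f z)(Σ_{z ∈ Π t_B} g z) = Σ_{z ∈ Π t_{A∪B}} f z g z`. [cite: Mastropietro2008, §2.3 (2.32)-(2.36)] -/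
theorem sum_piFinset_mul_sum_piFinset {A B : Finset (Option J)} (hAB : Disjoint A B) (f g : (J → S) → C)
    (hf : ∀ z z', (∀ j, some j ∈ A → z j = z' j) → f z = f z')
    (hg : ∀ z z', (∀ j, some j ∈ B → z j = z' j) → g z = g z') :
    (∑ z ∈ Fintype.piFinset (colours K z₀ A), f z) * ∑ z ∈ Fintype.piFinset (colours K z₀ B), g z
      = ∑ z ∈ Fintype.piFinset (colours K z₀ (A ∪ B)), f z * g z := by
  rw [sum_mul_sum, ← sum_product']
  refine sum_nbij' (fun p => fun j => if some j ∈ A then p.1 j else p.2 j)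
    (fun z => (fun j => if some j ∈ A then z j else z₀ j, fun j => if some j ∈ B then z j else z₀ j))
    ?_ ?_ ?_ ?_ ?_
  · rintro ⟨z₁, z₂⟩ hp
    obtain ⟨h₁, h₂⟩ := mem_product.1 hp
    obtain ⟨h₁K, h₁0⟩ := (mem_piFinset_colours K z₀).1 h₁
    obtain ⟨h₂K, h₂0⟩ := (mem_piFinset_colours K z₀).1 h₂
    refine (mem_piFinset_colours K z₀).2 ⟨fun j hj => ?_, fun j hj => ?_⟩
    · by_cases hjA : some j ∈ A
      · simp only [if_pos hjA]
        exact h₁K j hjA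
      · simp only [if_neg hjA]
        exact h₂K j ((mem_union.1 hj).resolve_left hjA)
    · have hjA : some j ∉ A := fun h => hj (mem_union_left _ h)
      have hjB : some j ∉ B := fun h => hj (mem_union_right _ h)
      simp only [if_neg hjA]
      exact h₂0 j hjB
  · intro z hz
    obtain ⟨hK, h0⟩ := (mem_piFinset_colours K z₀).1 hz
    refine mem_product.2 ⟨(mem_piFinset_colours K z₀).2 ⟨fun j hj => ?_, fun j hj => ?_⟩,
      (mem_piFinset_colours K z₀).2 ⟨fun j hj => ?_, fun j hj => ?_⟩⟩
    · simp only [if_pos hj]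
      exact hK j (mem_union_left _ hj)
    · simp only [if_neg hj]
    · simp only [if_pos hj]
      exact hK j (mem_union_right _ hj)
    · simp only [if_neg hj]
  · rintro ⟨z₁, z₂⟩ hp
    obtain ⟨h₁, h₂⟩ := mem_product.1 hp
    obtain ⟨-, h₁0⟩ := (mem_piFinset_colours K z₀).1 h₁
    obtain ⟨-, h₂0⟩ := (mem_piFinset_colours K z₀).1 h₂
    refine Prod.ext (funext fun j => ?_) (funext fun j => ?_)
    · by_cases hjA : some j ∈ A
      · simp only [if_pos hjA]
      · simp only [if_neg hjA]
        exact (h₁0 j hjA).symm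
    · by_cases hjB : some j ∈ B
      · have hjA : some j ∉ A := fun h => disjoint_left.1 hAB h hjB
        simp only [if_pos hjB, if_neg hjA]
      · simp only [if_neg hjB]
        exact (h₂0 j hjB).symm
  · intro z hz
    obtain ⟨-, h0⟩ := (mem_piFinset_colours K z₀).1 hz
    funext j
    by_cases hjA : some j ∈ A
    · simp only [if_pos hjA]
    · by_cases hjB : some j ∈ B
      · simp only [if_neg hjA, if_pos hjB]
      · simp only [if_neg hjA, if_neg hjB]
        exact (h0 j fun h => (mem_union.1 h).elim hjA hjB).symm
  · rintro ⟨z₁, z₂⟩ hp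
    obtain ⟨h₁, h₂⟩ := mem_product.1 hp
    refine congrArg₂ (· * ·) (hf _ _ fun j hj => ?_) (hg _ _ fun j hj => ?_)
    · simp only [if_pos hj]
    · have hjA : some j ∉ A := fun h => disjoint_left.1 hAB h hj
      simp only [if_neg hjA]

/-- On no vertex the only colouring is the base one. [folklore] -/
private theorem piFinset_colours_empty : Fintype.piFinset (colours K z₀ (∅ : Finset (Option J))) = {z₀} := by
  ext z
  rw [mem_piFinset_colours, mem_singleton]
  constructor
  · rintro ⟨-, h⟩
    exact funext fun j => h j (notMem_empty _)
  · rintro rfl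
    exact ⟨fun j h => absurd h (notMem_empty _), fun _ _ => rfl⟩

/-- **Exchange of a product of colour sums over the blocks of a set partition**: for `F P` depending only on the
colours of the clusters of `P`, and `π` a set partition of `V`,
`Π_{P∈π} Σ_{z ∈ Π t_P} F P z = Σ_{z ∈ Π t_V} Π_{P∈π} F P z`. [cite: Mastropietro2008, §2.3 (2.32)-(2.36)] -/
theorem prod_sum_piFinset_of_isSetPartition (F : Finset (Option J) → (J → S) → C)
    (hF : ∀ P z z', (∀ j, some j ∈ P → z j = z' j) → F P z = F P z') :
    ∀ (π : Finset (Finset (Option J))) (V : Finset (Option J)), IsSetPartition V π →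
      ∏ P ∈ π, ∑ z ∈ Fintype.piFinset (colours K z₀ P), F P z
        = ∑ z ∈ Fintype.piFinset (colours K z₀ V), ∏ P ∈ π, F P z := by
  intro π
  induction π using Finset.induction_on with
  | empty =>
    intro V hV
    have hV0 : V = ∅ := by
      rw [eq_empty_iff_forall_notMem]
      intro v hv
      obtain ⟨P, hP, -⟩ := hV.exists_mem hv
      exact notMem_empty P hP
    subst hV0
    simp [piFinset_colours_empty]
  | insert P₀ π' hP₀ ih =>
    intro V hV
    have hP₀mem : P₀ ∈ insert P₀ π' := mem_insert_self _ _
    have hP₀V : P₀ ⊆ V := hV.subset hP₀mem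
    have hrest : IsSetPartition (V \ P₀) π' := by
      have h := hV.erase hP₀mem
      rwa [erase_insert hP₀] at h
    have hdisj : Disjoint P₀ (V \ P₀) := disjoint_sdiff
    simp only [prod_insert hP₀]
    rw [ih (V \ P₀) hrest, sum_piFinset_mul_sum_piFinset K z₀ hdisj _ _ (hF P₀) ?_, union_sdiff_of_subset hP₀V]
    -- locality of the remaining product on `V \ P₀`
    intro z z' hzz'
    refine prod_congr rfl fun P hP => hF P z z' fun j hj => hzz' j (hrest.subset hP hj)

/-- **MULTILINEARITY OF THE URSELL FUNCTION IN THE CLUSTERS**: if the moments are sums over independent colourings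
of the clusters present, `m(P) = Σ_{z ∈ Π t_P} m_z(P)` with `m_z(P)` depending only on the colours of the clusters of
`P`, then for every nonempty `V`, `mᵀ(V) = Σ_{z ∈ Π t_V} m_zᵀ(V)` (*"𝓔ᵀ is multilinear"*, the derivative form
(2.32)). [cite: Mastropietro2008, §2.3 (2.32)-(2.36)] -/
theorem ursellOf_piFinset (m : Finset (Option J) → C) (mz : (J → S) → Finset (Option J) → C)
    (hloc : ∀ P z z', (∀ j, some j ∈ P → z j = z' j) → mz z P = mz z' P)
    (hsum : ∀ P, m P = ∑ z ∈ Fintype.piFinset (colours K z₀ P), mz z P) {V : Finset (Option J)}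
    (hV : V.Nonempty) :
    ursellOf m V = ∑ z ∈ Fintype.piFinset (colours K z₀ V), ursellOf (mz z) V := by
  symm
  refine eq_ursellOf_of_forall m (fun P => ∑ z ∈ Fintype.piFinset (colours K z₀ P), ursellOf (mz z) P) ?_ hV
  intro V hV
  have hlocT : ∀ P z z', (∀ j, some j ∈ P → z j = z' j) → ursellOf (mz z) P = ursellOf (mz z') P :=
    fun P z z' h => ursellOf_congr fun Q hQ => hloc Q z z' fun j hj => h j (hQ hj)
  rw [hsum V]
  calc ∑ π ∈ setPartitions V, ∏ P ∈ π, ∑ z ∈ Fintype.piFinset (colours K z₀ P), ursellOf (mz z) P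
      = ∑ π ∈ setPartitions V, ∑ z ∈ Fintype.piFinset (colours K z₀ V), ∏ P ∈ π, ursellOf (mz z) P :=
        sum_congr rfl fun π hπ =>
          prod_sum_piFinset_of_isSetPartition K z₀ (fun P z => ursellOf (mz z) P) hlocT π V
            (mem_setPartitions.1 hπ)
    _ = ∑ z ∈ Fintype.piFinset (colours K z₀ V), ∑ π ∈ setPartitions V, ∏ P ∈ π, ursellOf (mz z) P :=
        sum_comm
    _ = ∑ z ∈ Fintype.piFinset (colours K z₀ V), mz z V :=
        sum_congr rfl fun z _ => sum_setPartitions_prod_ursellOf (mz z) hV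

end PiFinset

end Literature.Probability.LatticeModels
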